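import Mathlib
import Literature.Analysis.Calculus.SmoothstepPolygon
import Summits.AtomisticToContinuum.HydrodynamicLimit.Theorems.ImplosionDichotomyDenseExcursionSonicSlavingWedgePieces

/-!
# The closed contour of the sonic-slaving proof: a `C¹` twelve-edge polygonal loop around the sonic point
# (crux `DenseExcursion`, line `sonic-cavity-renewal` v7, brick (M4)-(P1) for the registered stub `stub_sonicSlaving`)

Helper file (`--supports stmt-AtomisticToContinuum-12586`, line lead a2, stub-worker A (wave 3) for `stub_sonicSlaving`).

The contour-transport proof of `SonicSlaving` (worker report `work/stubs/A_sonicSlaving.REPORT.md` §2) transports the slaved gauge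
of a smooth radial mode once around the sonic point along the closed polygon with vertices
`A₀ = x_m = −7/10`, `A₁ = x_m − η_m i` (`η_m = 189/2000`), `A₂ = −(1/25)(1 + θ i)` (`θ = 27/200`, the lower wedge ray),
`A₃ … A₉` an octagon of radius `≈ 1/25` around `0` through the right half-plane, `A₁₀ = −(1/25)(1 − θ i)`, `A₁₁ = x_m + η_m i`,
`A₁₂ = x_m` — leaving the real axis DOWNWARDS (the suppressed side for `Im Λ > 0`) and returning from above. This file builds it:
`exists_sonicLoop` (registered helper) — the smoothstep parametrization `y : [0, 12] → ℂ` of `Literature.Analysis.Calculus`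
(`C¹`, stopping at the vertices), together with everything the estimate consumes: `y` stays in the punctured sonic wedge and in the
region of the loop clause's sup bounds (`−7/10 ≤ Re z ≤ 0`, `|Im z| ≤ θ|Re z|`, or `‖z‖ ≤ 9/200`), the cellwise description
`y σ = A_k + s(A_{k+1} − A_k)`, `y′ σ = c (A_{k+1} − A_k)`, `c ≥ 0`, the first leg (`y′ = c·(−η_m i)`, `y = x_m + η i`, `|η| ≤ η_m`),
`∫₀¹ ‖y′‖ = η_m`, `∫₀¹² ‖y′‖ ≤ 2`, `‖A_{k+1} − A_k‖ ≤ 1`. Elementary plane geometry; no citation is load-bearing.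
-/

noncomputable section

open Set Filter MeasureTheory intervalIntegral Complex
open scoped Topology

namespace Summit.AtomisticToContinuum.HydrodynamicLimit.Theorems.SonicCavityRenewal

/-! ## Two convex cells of the punctured wedge -/

/-- Norm bound from coordinates. [folklore] -/
theorem norm_le_of_sq_le {z : ℂ} {c : ℝ} (hc : 0 ≤ c) (h : z.re ^ 2 + z.im ^ 2 ≤ c ^ 2) : ‖z‖ ≤ c := by
  rw [Complex.norm_eq_sqrt_sq_add_sq, Real.sqrt_le_left]
  · exact h
  · exact hc

/-- **The wedge cell** `−7/10 ≤ Re z ≤ −1/25`, `|Im z| ≤ (27/200)|Re z|` is convex: a point of a segment with both ends in it is in it,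
hence in the punctured sonic wedge and in the region of the clause's sup bounds. [folklore] -/
theorem wedgeCell_segment {P Q : ℂ} {s : ℝ} (hs0 : 0 ≤ s) (hs1 : s ≤ 1) (hP1 : -(7 / 10 : ℝ) ≤ P.re) (hP2 : P.re ≤ -(1 / 25 : ℝ))
    (hP3 : |P.im| ≤ -(27 / 200 * P.re)) (hQ1 : -(7 / 10 : ℝ) ≤ Q.re) (hQ2 : Q.re ≤ -(1 / 25 : ℝ)) (hQ3 : |Q.im| ≤ -(27 / 200 * Q.re)) :
    P + (s : ℂ) * (Q - P) ∈ sonicWedge ∧ P + (s : ℂ) * (Q - P) ≠ 0 ∧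
      ((-(7 / 10 : ℝ) ≤ (P + (s : ℂ) * (Q - P)).re ∧ (P + (s : ℂ) * (Q - P)).re ≤ 0 ∧
        |(P + (s : ℂ) * (Q - P)).im| ≤ 27 / 200 * |(P + (s : ℂ) * (Q - P)).re|) ∨ ‖P + (s : ℂ) * (Q - P)‖ ≤ 9 / 200) := by
  have hre : (P + (s : ℂ) * (Q - P)).re = P.re + s * (Q.re - P.re) := by simp
  have him : (P + (s : ℂ) * (Q - P)).im = P.im + s * (Q.im - P.im) := by simp
  have h1 : -(7 / 10 : ℝ) ≤ P.re + s * (Q.re - P.re) := by nlinarith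
  have h2 : P.re + s * (Q.re - P.re) ≤ -(1 / 25 : ℝ) := by nlinarith
  have h3 : |P.im + s * (Q.im - P.im)| ≤ -(27 / 200 * (P.re + s * (Q.re - P.re))) := by
    obtain ⟨a1, a2⟩ := abs_le.1 hP3
    obtain ⟨b1, b2⟩ := abs_le.1 hQ3
    refine abs_le.2 ⟨?_, ?_⟩ <;> nlinarith
  have hneg : P.re + s * (Q.re - P.re) < 0 := by linarith
  refine ⟨?_, ?_, Or.inl ⟨?_, ?_, ?_⟩⟩
  · rw [mem_sonicWedge_iff, hre, him]
    refine ⟨by linarith, by linarith, lt_max_of_lt_left ?_⟩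
    rw [abs_of_neg hneg]
    have : -(27 / 200 * (P.re + s * (Q.re - P.re))) < 3 / 20 * -(P.re + s * (Q.re - P.re)) := by nlinarith
    exact h3.trans_lt this
  · intro h
    have := congrArg Complex.re h
    rw [hre, Complex.zero_re] at this
    linarith
  · rw [hre]; exact h1
  · rw [hre]; linarith
  · rw [hre, him, abs_of_neg hneg]; linarith

/-- **The disc cell** `‖z‖ ≤ 9/200`: a point of a segment with both ends in it and both ends strictly on one side of a coordinate
axis is in the disc, non-zero, in the sonic wedge, and in the region of the clause's sup bounds. [folklore] -/
theorem discCell_segment {P Q : ℂ} {s : ℝ} (hs0 : 0 ≤ s) (hs1 : s ≤ 1) (hP : P.re ^ 2 + P.im ^ 2 ≤ (9 / 200 : ℝ) ^ 2)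
    (hQ : Q.re ^ 2 + Q.im ^ 2 ≤ (9 / 200 : ℝ) ^ 2)
    (hside : (0 < P.re ∧ 0 < Q.re) ∨ (P.re < 0 ∧ Q.re < 0) ∨ (0 < P.im ∧ 0 < Q.im) ∨ (P.im < 0 ∧ Q.im < 0)) :
    P + (s : ℂ) * (Q - P) ∈ sonicWedge ∧ P + (s : ℂ) * (Q - P) ≠ 0 ∧
      ((-(7 / 10 : ℝ) ≤ (P + (s : ℂ) * (Q - P)).re ∧ (P + (s : ℂ) * (Q - P)).re ≤ 0 ∧
        |(P + (s : ℂ) * (Q - P)).im| ≤ 27 / 200 * |(P + (s : ℂ) * (Q - P)).re|) ∨ ‖P + (s : ℂ) * (Q - P)‖ ≤ 9 / 200) := by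
  have hre : (P + (s : ℂ) * (Q - P)).re = P.re + s * (Q.re - P.re) := by simp
  have him : (P + (s : ℂ) * (Q - P)).im = P.im + s * (Q.im - P.im) := by simp
  have hPn : ‖P‖ ≤ 9 / 200 := norm_le_of_sq_le (by norm_num) hP
  have hQn : ‖Q‖ ≤ 9 / 200 := norm_le_of_sq_le (by norm_num) hQ
  have hnorm : ‖P + (s : ℂ) * (Q - P)‖ ≤ 9 / 200 := by
    have e : P + (s : ℂ) * (Q - P) = ((1 - s : ℝ) : ℂ) * P + (s : ℂ) * Q := by push_cast; ring
    rw [e]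
    calc ‖((1 - s : ℝ) : ℂ) * P + (s : ℂ) * Q‖ ≤ ‖((1 - s : ℝ) : ℂ) * P‖ + ‖(s : ℂ) * Q‖ := norm_add_le _ _
      _ = (1 - s) * ‖P‖ + s * ‖Q‖ := by
          rw [norm_mul, norm_mul, Complex.norm_real, Complex.norm_real, Real.norm_eq_abs, Real.norm_eq_abs,
            abs_of_nonneg (by linarith), abs_of_nonneg hs0]
      _ ≤ (1 - s) * (9 / 200) + s * (9 / 200) := add_le_add (mul_le_mul_of_nonneg_left hPn (by linarith))
          (mul_le_mul_of_nonneg_left hQn hs0)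
      _ = 9 / 200 := by ring
  have hne : P + (s : ℂ) * (Q - P) ≠ 0 := by
    intro h
    have h1 := congrArg Complex.re h
    have h2 := congrArg Complex.im h
    rw [hre, Complex.zero_re] at h1
    rw [him, Complex.zero_im] at h2
    rcases hside with ⟨a, b⟩ | ⟨a, b⟩ | ⟨a, b⟩ | ⟨a, b⟩ <;> nlinarith
  refine ⟨ball_subset_sonicWedge (δ := 1 / 20) le_rfl ?_, hne, Or.inr hnorm⟩
  rw [mem_ball_zero_iff]; linarith

/-! ## The twelve vertices -/

/-- The vertex data of the contour: every edge has both ends in the wedge cell, or both ends in the disc cell strictly on one side of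
an axis; and its `ℓ¹`-length. [folklore] -/
theorem sonicLoop_vertices : let A : Fin 13 → ℂ := ![((-(7 / 10 : ℝ)) : ℂ), ((-(7 / 10 : ℝ)) : ℂ) - (189 / 2000 : ℝ) * I,
      ((-(1 / 25 : ℝ)) : ℂ) - (27 / 5000 : ℝ) * I, ((-(3 / 100 : ℝ)) : ℂ) - (3 / 100 : ℝ) * I, -((1 / 25 : ℝ) : ℂ) * I,
      ((3 / 100 : ℝ) : ℂ) - (3 / 100 : ℝ) * I, ((1 / 25 : ℝ) : ℂ), ((3 / 100 : ℝ) : ℂ) + (3 / 100 : ℝ) * I, ((1 / 25 : ℝ) : ℂ) * I,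
      ((-(3 / 100 : ℝ)) : ℂ) + (3 / 100 : ℝ) * I, ((-(1 / 25 : ℝ)) : ℂ) + (27 / 5000 : ℝ) * I, ((-(7 / 10 : ℝ)) : ℂ) + (189 / 2000 : ℝ) * I,
      ((-(7 / 10 : ℝ)) : ℂ)];
    ∀ k : Fin 12,
      ((-(7 / 10 : ℝ) ≤ (A k.castSucc).re ∧ (A k.castSucc).re ≤ -(1 / 25 : ℝ) ∧ |(A k.castSucc).im| ≤ -(27 / 200 * (A k.castSucc).re) ∧
        -(7 / 10 : ℝ) ≤ (A k.succ).re ∧ (A k.succ).re ≤ -(1 / 25 : ℝ) ∧ |(A k.succ).im| ≤ -(27 / 200 * (A k.succ).re)) ∨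
       ((A k.castSucc).re ^ 2 + (A k.castSucc).im ^ 2 ≤ (9 / 200 : ℝ) ^ 2 ∧ (A k.succ).re ^ 2 + (A k.succ).im ^ 2 ≤ (9 / 200 : ℝ) ^ 2 ∧
        ((0 < (A k.castSucc).re ∧ 0 < (A k.succ).re) ∨ ((A k.castSucc).re < 0 ∧ (A k.succ).re < 0) ∨
          (0 < (A k.castSucc).im ∧ 0 < (A k.succ).im) ∨ ((A k.castSucc).im < 0 ∧ (A k.succ).im < 0)))) ∧
      |(A k.succ - A k.castSucc).re| + |(A k.succ - A k.castSucc).im| ≤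
        (![189 / 2000, 7491 / 10000, 173 / 5000, 1 / 25, 1 / 25, 1 / 25, 1 / 25, 1 / 25, 1 / 25, 173 / 5000, 7491 / 10000, 189 / 2000] :
          Fin 12 → ℝ) k := by
  intro A k
  fin_cases k <;> simp [A] <;> norm_num [abs_of_pos, abs_of_neg]


/-! ## The contour -/

/-- **THE CLOSED CONTOUR OF THE SONIC-SLAVING PROOF** — registered helper `exists_sonicLoop` for `stub_sonicSlaving`: a `C¹` loop
`y : [0, 12] → ℂ` based at the matching point `x_m = −7/10`, first descending vertically to depth `η_m = 189/2000`, then along the lower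
wedge ray to `−(1/25)(1 + (27/200) i)`, counter-clockwise around the sonic point on an octagon inside `‖z‖ ≤ 9/200`, back along the
upper ray and down to `x_m`; with the cellwise description and the length budgets consumed by the loop estimate. [folklore] -/
theorem exists_sonicLoop : ∃ A : Fin 13 → ℂ, A = ![((-(7 / 10 : ℝ)) : ℂ), ((-(7 / 10 : ℝ)) : ℂ) - (189 / 2000 : ℝ) * Complex.I, ((-(1 / 25 : ℝ)) : ℂ) - (27 / 5000 : ℝ) * Complex.I, ((-(3 / 100 : ℝ)) : ℂ) - (3 / 100 : ℝ) * Complex.I, -((1 / 25 : ℝ) : ℂ) * Complex.I, ((3 / 100 : ℝ) : ℂ) - (3 / 100 : ℝ) * Complex.I, ((1 / 25 : ℝ) : ℂ), ((3 / 100 : ℝ) : ℂ) + (3 / 100 : ℝ) * Complex.I, ((1 / 25 : ℝ) : ℂ) * Complex.I, ((-(3 / 100 : ℝ)) : ℂ) + (3 / 100 : ℝ) * Complex.I, ((-(1 / 25 : ℝ)) : ℂ) + (27 / 5000 : ℝ) * Complex.I, ((-(7 / 10 : ℝ)) : ℂ) + (189 / 2000 : ℝ) * Complex.I, ((-(7 /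 10 : ℝ)) : ℂ)] ∧ ∃ y dy : ℝ → ℂ, Continuous y ∧ Continuous dy ∧ (∀ σ : ℝ, HasDerivAt y (dy σ) σ) ∧ y 0 = ((-(7 / 10 : ℝ)) : ℂ) ∧ y 12 = ((-(7 / 10 : ℝ)) : ℂ) ∧ (∀ σ ∈ Set.Icc (0 : ℝ) 12, y σ ∈ sonicWedge ∧ y σ ≠ 0 ∧ ((-(7 / 10 : ℝ) ≤ (y σ).re ∧ (y σ).re ≤ 0 ∧ |(y σ).im| ≤ 27 / 200 * |(y σ).re|) ∨ ‖y σ‖ ≤ 9 / 200) ∧ ∃ k : Fin 12, ∃ s ∈ Set.Icc (0 : ℝ) 1, ∃ c : ℝ, 0 ≤ c ∧ y σ = A k.castSucc + (s : ℂ) * (A k.succ - A k.castSucc) ∧ dy σ = (c : ℂ) * (A k.succ - A k.castSucc)) ∧ (∀ σ ∈ Set.Icc (0 : ℝ) 1, ∃ c : ℝ, 0 ≤ c ∧ dy σ = (c : ℂ) * (-((189 / 2000 : ℝ) : ℂ) * Complex.I) ∧ ∃ η : ℝ, |η| ≤ 189 / 2000 ∧ y σ = ((-(7 / 10 : ℝ))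 : ℂ) + (η : ℂ) * Complex.I) ∧ (∫ σ in (0 : ℝ)..1, ‖dy σ‖ = 189 / 2000) ∧ (∫ σ in (0 : ℝ)..12, ‖dy σ‖ ≤ 2) ∧ (∀ k : Fin 12, ‖A k.succ - A k.castSucc‖ ≤ 1) := by
  refine ⟨_, rfl, ?_⟩
  set A : Fin 13 → ℂ := ![((-(7 / 10 : ℝ)) : ℂ), ((-(7 / 10 : ℝ)) : ℂ) - (189 / 2000 : ℝ) * Complex.I,
    ((-(1 / 25 : ℝ)) : ℂ) - (27 / 5000 : ℝ) * Complex.I, ((-(3 / 100 : ℝ)) : ℂ) - (3 / 100 : ℝ) * Complex.I, -((1 / 25 : ℝ) : ℂ) * Complex.I,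
    ((3 / 100 : ℝ) : ℂ) - (3 / 100 : ℝ) * Complex.I, ((1 / 25 : ℝ) : ℂ), ((3 / 100 : ℝ) : ℂ) + (3 / 100 : ℝ) * Complex.I, ((1 / 25 : ℝ) : ℂ) * Complex.I,
    ((-(3 / 100 : ℝ)) : ℂ) + (3 / 100 : ℝ) * Complex.I, ((-(1 / 25 : ℝ)) : ℂ) + (27 / 5000 : ℝ) * Complex.I,
    ((-(7 / 10 : ℝ)) : ℂ) + (189 / 2000 : ℝ) * Complex.I, ((-(7 / 10 : ℝ)) : ℂ)] with hA
  obtain ⟨y, dy, hyc, hdyc, hder, hy0, hy12, hdy0, hdy12, hcell, hint⟩ := Literature.Analysis.Calculus.exists_smoothstep_polygon 12 A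
  have hvert := sonicLoop_vertices
  simp only [← hA] at hvert
  -- edge ℓ¹-lengths and their sum
  have hL1 : ∀ k : Fin 12, ‖A k.succ - A k.castSucc‖ ≤
      (![189 / 2000, 7491 / 10000, 173 / 5000, 1 / 25, 1 / 25, 1 / 25, 1 / 25, 1 / 25, 1 / 25, 173 / 5000, 7491 / 10000, 189 / 2000] :
        Fin 12 → ℝ) k :=
    fun k => (Complex.norm_le_abs_re_add_abs_im _).trans (hvert k).2
  refine ⟨y, dy, hyc, hdyc, hder, hy0, ?_, ?_, ?_, ?_, ?_, fun k => (hL1 k).trans ?_⟩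
  · rw [show ((12 : ℕ) : ℝ) = 12 by norm_num] at hy12
    rw [hy12]; simp [hA]
  · -- along the loop
    intro σ hσ
    obtain ⟨k, hk⟩ := Literature.Analysis.Calculus.exists_fin_mem_Icc (n := 12) (by norm_num) (by simpa using hσ)
    obtain ⟨s, hs, c, hc, e1, e2⟩ := hcell k σ hk
    have hgeom : y σ ∈ sonicWedge ∧ y σ ≠ 0 ∧ ((-(7 / 10 : ℝ) ≤ (y σ).re ∧ (y σ).re ≤ 0 ∧
        |(y σ).im| ≤ 27 / 200 * |(y σ).re|) ∨ ‖y σ‖ ≤ 9 / 200) := by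
      rw [e1]
      rcases (hvert k).1 with ⟨h1, h2, h3, h4, h5, h6⟩ | ⟨h1, h2, h3⟩
      · exact wedgeCell_segment hs.1 hs.2 h1 h2 h3 h4 h5 h6
      · exact discCell_segment hs.1 hs.2 h1 h2 h3
    exact ⟨hgeom.1, hgeom.2.1, hgeom.2.2, k, s, hs, c, hc, e1, e2⟩
  · -- the first leg
    intro σ hσ
    obtain ⟨s, hs, c, hc, e1, e2⟩ := hcell 0 σ (by simpa using hσ)
    refine ⟨c, hc, ?_, -(189 / 2000) * s, ?_, ?_⟩
    · rw [e2]; congr 1; simp [hA]; ring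
    · rw [abs_mul, abs_of_neg (by norm_num : (-(189 / 2000) : ℝ) < 0), abs_of_nonneg hs.1]; nlinarith [hs.2]
    · rw [e1]; simp [hA]; ring
  · -- the first edge length
    have h := hint 0
    have e : A (0 : Fin 12).succ - A (0 : Fin 12).castSucc = -((189 / 2000 : ℝ) : ℂ) * Complex.I := by simp [hA]; ring
    rw [e, norm_mul, norm_neg, Complex.norm_real, Complex.norm_I, mul_one, Real.norm_eq_abs,
      abs_of_pos (by norm_num : (0 : ℝ) < 189 / 2000)] at h
    simpa using h
  · -- the total length
    have hii : ∀ k < 12, IntervalIntegrable (fun σ => ‖dy σ‖) volume ((k : ℕ) : ℝ) ((k + 1 : ℕ) : ℝ) :=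
      fun k _ => (hdyc.norm).intervalIntegrable _ _
    have hsum := intervalIntegral.sum_integral_adjacent_intervals hii
    simp only [Nat.cast_zero, Nat.cast_ofNat] at hsum
    rw [← hsum]
    have hterm : ∀ k ∈ Finset.range 12, ∫ σ in ((k : ℕ) : ℝ)..((k + 1 : ℕ) : ℝ), ‖dy σ‖ ≤
        (fun k : ℕ => if h : k < 12 then (![189 / 2000, 7491 / 10000, 173 / 5000, 1 / 25, 1 / 25, 1 / 25, 1 / 25, 1 / 25, 1 / 25,
          173 / 5000, 7491 / 10000, 189 / 2000] : Fin 12 → ℝ) ⟨k, h⟩ else 0) k := by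
      intro k hk
      rw [Finset.mem_range] at hk
      simp only [hk, dite_true]
      have h := hint ⟨k, hk⟩
      have e : ∫ σ in ((k : ℕ) : ℝ)..((k + 1 : ℕ) : ℝ), ‖dy σ‖ = ∫ σ in (((⟨k, hk⟩ : Fin 12) : ℕ) : ℝ)..(((⟨k, hk⟩ : Fin 12) : ℕ) + 1), ‖dy σ‖ := by
        simp
      rw [e, h]
      exact hL1 ⟨k, hk⟩
    refine (Finset.sum_le_sum hterm).trans ?_
    simp [Finset.sum_range_succ]
    norm_num
  · fin_cases k <;> simp <;> norm_num

end Summit.AtomisticToContinuum.HydrodynamicLimit.Theorems.SonicCavityRenewal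

end
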